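import Summits.KontsevichZagierPeriods.KontsevichZagierPeriods.Theses.GaussManinCertificates
import Literature.NumberTheory.Transcendental.KZLogCalculus

/-!
# Birth skeleton of piece `KZStokesBand` (typed decomposition of crux `KZStokes`, stmt-KontsevichZagierPeriods-3012)

`KZStokesBand` (Newton–Leibniz on ONE open band with a primitive vanishing at both ends) from two stubs:

* `stub_closedBandNewtonLeibniz` — the CLOSED-band statement: for `R` with domain the closed band
  `{(x,t) | x ∈ S, a x ≤ t ≤ b x}` (`a ≤ b`), `H` `ℚ`-semialgebraic on it, fibrewise continuous on
  `[a x, b x]`, zero at both ends, derivative `R.integrand` inside: `[R] ∈ KZ.relations` (ONE instance of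
  `KZ.newtonLeibnizRel` with base the zero representation `[S, 0]`, itself a relation);
* `stub_openToClosedBand` — the open band carries, modulo relations, a representation on the closed band
  with the same integrand on the open band (zero-extension of the integrand; the two edge graphs are null:
  domain additivity);
* `KZStokesBand_of_subs` — composition (proved): extend, apply the closed-band move, subtract.

Pattern: `Theorems/GaussManinCertificatesKZStokesBox.lean` (`KZStokesBox_proof`) with the box replaced by
the band. Sorries ONLY in the two stubs.
-/

noncomputable section

open MeasureTheory Set
open Literature.ModelTheory.ExponentialFields (IsSemialgebraic)
open Literature.NumberTheory.Transcendental

-- `Summit.KontsevichZagierPeriods.KontsevichZagierPeriods.…` is the tree's mandated layout (single-conjunct summit).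
set_option linter.dupNamespace false

namespace Summit.KontsevichZagierPeriods.KontsevichZagierPeriods.Cruxes.KZStokes.StokesBandBirth

/-- Piece `KZStokesBand` of the typed decomposition of `KZStokes` (verbatim). [Kontsevich–Zagier 2001, §1.2, rule 3)] -/
def KZStokesBand : Prop :=
  ∀ (n : ℕ) (S : Set (Fin n → ℝ)) (a b : (Fin n → ℝ) → ℝ) (r : Literature.NumberTheory.Transcendental.KZ.IntegralRep (n + 1)) (H : (Fin (n + 1) → ℝ) → ℝ), Literature.ModelTheory.ExponentialFields.IsSemialgebraic ℚ S → Literature.NumberTheory.Transcendental.IsSemialgebraicFunOn ℚ S a → Literature.NumberTheory.Transcendental.IsSemialgebraicFunOn ℚ S b → (∀ x ∈ S, a x < b x) → r.domain = {z : Fin (n + 1) → ℝ | Fin.init z ∈ S ∧ z (Fin.last n) ∈ Set.Ioo (a (Fin.init z)) (b (Fin.init z))} → Literature.NumberTheory.Transcendental.IsSemialgebraicFunOn ℚ {z : Fin (n + 1) → ℝ | Fin.init z ∈ S ∧ z (Fin.last n) ∈ Set.Icc (a (Fin.init z)) (b (Fin.init z))} H → (∀ x ∈ S, ContinuousOn (fun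 s : ℝ => H (Fin.snoc x s)) (Set.Icc (a x) (b x)) ∧ H (Fin.snoc x (a x)) = 0 ∧ H (Fin.snoc x (b x)) = 0 ∧ ∀ t ∈ Set.Ioo (a x) (b x), HasDerivAt (fun s : ℝ => H (Fin.snoc x s)) (r.integrand (Fin.snoc x t)) t) → Literature.NumberTheory.Transcendental.KZ.of r ∈ Literature.NumberTheory.Transcendental.KZ.relations

/-- STUB 1: closed-band Newton–Leibniz with vanishing boundary values (one `KZ.newtonLeibnizRel`
over the zero base representation). [Kontsevich–Zagier 2001, §1.2, rule 3)] -/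
theorem stub_closedBandNewtonLeibniz :
    ∀ (n : ℕ) (S : Set (Fin n → ℝ)) (a b : (Fin n → ℝ) → ℝ)
      (R : Literature.NumberTheory.Transcendental.KZ.IntegralRep (n + 1)) (H : (Fin (n + 1) → ℝ) → ℝ),
      Literature.ModelTheory.ExponentialFields.IsSemialgebraic ℚ S →
      Literature.NumberTheory.Transcendental.IsSemialgebraicFunOn ℚ S a →
      Literature.NumberTheory.Transcendental.IsSemialgebraicFunOn ℚ S b →
      (∀ x ∈ S, a x ≤ b x) →
      R.domain = {z : Fin (n + 1) → ℝ | Fin.init z ∈ S ∧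
        z (Fin.last n) ∈ Set.Icc (a (Fin.init z)) (b (Fin.init z))} →
      Literature.NumberTheory.Transcendental.IsSemialgebraicFunOn ℚ R.domain H →
      (∀ x ∈ S, ContinuousOn (fun s : ℝ => H (Fin.snoc x s)) (Set.Icc (a x) (b x)) ∧
        H (Fin.snoc x (a x)) = 0 ∧ H (Fin.snoc x (b x)) = 0 ∧
        ∀ t ∈ Set.Ioo (a x) (b x),
          HasDerivAt (fun s : ℝ => H (Fin.snoc x s)) (R.integrand (Fin.snoc x t)) t) →
      Literature.NumberTheory.Transcendental.KZ.of R ∈ Literature.NumberTheory.Transcendental.KZ.relations := by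
  sorry

/-- STUB 2: the open band is, modulo relations, the closed band with the zero-extended integrand
(the two edge graphs are null). [Kontsevich–Zagier 2001, §1.2, rule 1)] -/
theorem stub_openToClosedBand :
    ∀ (n : ℕ) (S : Set (Fin n → ℝ)) (a b : (Fin n → ℝ) → ℝ)
      (r : Literature.NumberTheory.Transcendental.KZ.IntegralRep (n + 1)),
      Literature.ModelTheory.ExponentialFields.IsSemialgebraic ℚ S →
      Literature.NumberTheory.Transcendental.IsSemialgebraicFunOn ℚ S a →
      Literature.NumberTheory.Transcendental.IsSemialgebraicFunOn ℚ S b →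
      (∀ x ∈ S, a x < b x) →
      r.domain = {z : Fin (n + 1) → ℝ | Fin.init z ∈ S ∧
        z (Fin.last n) ∈ Set.Ioo (a (Fin.init z)) (b (Fin.init z))} →
      ∃ R : Literature.NumberTheory.Transcendental.KZ.IntegralRep (n + 1),
        R.domain = {z : Fin (n + 1) → ℝ | Fin.init z ∈ S ∧
          z (Fin.last n) ∈ Set.Icc (a (Fin.init z)) (b (Fin.init z))} ∧
        Set.EqOn R.integrand r.integrand r.domain ∧
        Literature.NumberTheory.Transcendental.KZ.of R - Literature.NumberTheory.Transcendental.KZ.of r ∈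
          Literature.NumberTheory.Transcendental.KZ.relations := by
  sorry

/-- **Composition**: the two stubs give `KZStokesBand`. [Kontsevich–Zagier 2001, §1.2, rules 1) and 3)] -/
theorem KZStokesBand_of_subs
    (h1 : ∀ (n : ℕ) (S : Set (Fin n → ℝ)) (a b : (Fin n → ℝ) → ℝ)
      (R : Literature.NumberTheory.Transcendental.KZ.IntegralRep (n + 1)) (H : (Fin (n + 1) → ℝ) → ℝ),
      Literature.ModelTheory.ExponentialFields.IsSemialgebraic ℚ S →
      Literature.NumberTheory.Transcendental.IsSemialgebraicFunOn ℚ S a →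
      Literature.NumberTheory.Transcendental.IsSemialgebraicFunOn ℚ S b →
      (∀ x ∈ S, a x ≤ b x) →
      R.domain = {z : Fin (n + 1) → ℝ | Fin.init z ∈ S ∧
        z (Fin.last n) ∈ Set.Icc (a (Fin.init z)) (b (Fin.init z))} →
      Literature.NumberTheory.Transcendental.IsSemialgebraicFunOn ℚ R.domain H →
      (∀ x ∈ S, ContinuousOn (fun s : ℝ => H (Fin.snoc x s)) (Set.Icc (a x) (b x)) ∧
        H (Fin.snoc x (a x)) = 0 ∧ H (Fin.snoc x (b x)) = 0 ∧
        ∀ t ∈ Set.Ioo (a x) (b x),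
          HasDerivAt (fun s : ℝ => H (Fin.snoc x s)) (R.integrand (Fin.snoc x t)) t) →
      Literature.NumberTheory.Transcendental.KZ.of R ∈ Literature.NumberTheory.Transcendental.KZ.relations)
    (h2 : ∀ (n : ℕ) (S : Set (Fin n → ℝ)) (a b : (Fin n → ℝ) → ℝ)
      (r : Literature.NumberTheory.Transcendental.KZ.IntegralRep (n + 1)),
      Literature.ModelTheory.ExponentialFields.IsSemialgebraic ℚ S →
      Literature.NumberTheory.Transcendental.IsSemialgebraicFunOn ℚ S a →
      Literature.NumberTheory.Transcendental.IsSemialgebraicFunOn ℚ S b →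
      (∀ x ∈ S, a x < b x) →
      r.domain = {z : Fin (n + 1) → ℝ | Fin.init z ∈ S ∧
        z (Fin.last n) ∈ Set.Ioo (a (Fin.init z)) (b (Fin.init z))} →
      ∃ R : Literature.NumberTheory.Transcendental.KZ.IntegralRep (n + 1),
        R.domain = {z : Fin (n + 1) → ℝ | Fin.init z ∈ S ∧
          z (Fin.last n) ∈ Set.Icc (a (Fin.init z)) (b (Fin.init z))} ∧
        Set.EqOn R.integrand r.integrand r.domain ∧
        Literature.NumberTheory.Transcendental.KZ.of R - Literature.NumberTheory.Transcendental.KZ.of r ∈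
          Literature.NumberTheory.Transcendental.KZ.relations) :
    KZStokesBand := by
  intro n S a b r H hS ha hb hab hdom hH hfib
  obtain ⟨R, hRd, hRi, hRr⟩ := h2 n S a b r hS ha hb hab hdom
  have hR : KZ.of R ∈ KZ.relations := by
    refine h1 n S a b R H hS ha hb (fun x hx => (hab x hx).le) hRd (by rw [hRd]; exact hH)
      fun x hx => ?_
    obtain ⟨hc, h0, h1', hd⟩ := hfib x hx
    refine ⟨hc, h0, h1', fun t ht => ?_⟩
    have hmem : (Fin.snoc x t : Fin (n + 1) → ℝ) ∈ r.domain := by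
      rw [hdom]
      simp only [mem_setOf_eq, Fin.init_snoc, Fin.snoc_last]
      exact ⟨hx, ht⟩
    rw [hRi hmem]
    exact hd t ht
  have heq : KZ.of r = KZ.of R - (KZ.of R - KZ.of r) := by abel
  rw [heq]
  exact sub_mem hR hRr

/-- `KZStokesBand` from the two stubs. [Kontsevich–Zagier 2001, §1.2] -/
theorem KZStokesBand_of : KZStokesBand :=
  KZStokesBand_of_subs stub_closedBandNewtonLeibniz stub_openToClosedBand

end Summit.KontsevichZagierPeriods.KontsevichZagierPeriods.Cruxes.KZStokes.StokesBandBirth
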